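import Literature.MathematicalPhysics.QuantumLattice.HubbardNNNHoppingTorusLimitCorrelatorWindow
import HarnessLib

/-!
# `t–t'` Hubbard model: ONE correlator window certificate bounds the correlators of the torus-limit
# ground states of EVERY density of a filling box `n ∈ [n₁, n₂]`

Family `hubbard` (topic `MathematicalPhysics/QuantumLattice`). Companion of
`HubbardNNNHoppingTorusLimitCorrelatorWindow.lean`, whose theorem
`InfVolFermionState.IsTorusLimitOf.re_expect_ge_of_window_certificate_TT'_ineq_of_window` turns a window
identity (`κ₊, κ₋ ≥ 0`, energy slots `hi`, `lo`, density multipliers `μ_σ` with slot `ν`) plus a certified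
window `lo ≤ e(n) ≤ hi` AT ONE DENSITY `n` into the bound
`c − Σₖ ‖aₖ‖ + (Σ_σ μ_σ)(n/2 − ν) ≤ Re ω(X)` for every torus-limit ground state `ω` of density `n`.
Written for the material-oracle pipeline (downfold ↦ certifier): the downfold hands over a FILLING BOX,
not a density. Two observations make the same certificate a BOX certificate (Wang et al. 2024 §III:
the energy half-spaces enter only as constraints, so any window valid on the box may be used; the
operator identity itself does not mention `n`):

* the identity `hcert` is density-free — `n` enters only through the window hypothesis and through
  the class of states (`IsGroundStateInSector … (rectN n L) …`);
* the bound is AFFINE in `n`, so on a box it is at least the smaller of its two endpoint values.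

Hence `…_of_fillingBox` below: if `lo ≤ e(x) ≤ hi` for EVERY `x ∈ [n₁, n₂]` (a box window — e.g. the
box cap `max u₁ u₂` of two bracketing certified caps and the box floor of a secant extension or of a
supporting line, `HubbardFillingBoxEnergyBounds.lean`; or simply the chord
`energyDensityTT'_le_density_chord` and `energyDensityTT'_ge_density_extrapolate_right/left`), then for
every `n ∈ [n₁, n₂]` and every torus-limit ground state `ω` of density `n`,
`min (c − Σ‖a‖ + (Σμ)(n₁/2 − ν)) (c − Σ‖a‖ + (Σμ)(n₂/2 − ν)) ≤ Re ω(X)` — one certificate, two endpoint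
evaluations, the whole filling box; the `D₄` orbit-mean form `…d4…_of_fillingBox` likewise.
HONEST SCOPE: soundness edge only; no number, no claim on any ground state; the sharpness lost is exactly
the widening of the window from a point to the box. Everything is PROVED; no definition, no named fact.

## References
* J. Wang, J. Surace, I. Frérot, B. Legat, M.-O. Renou, V. Magron, A. Acín, *Certifying ground-state
  properties of many-body systems*, Phys. Rev. X 14 (2024) 031006, §III eq. (obsopt).
  [cite: WangEtAl2024, §III]
* D. Ruelle, *Statistical Mechanics: Rigorous Results* (1969), §3.3 (convexity of the energy density in
  the density — the source of box windows). [cite: Ruelle1969, §3.3]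
-/

noncomputable section

namespace Literature.MathematicalPhysics.QuantumLattice

open Matrix Finset HubbardWave0 Literature.Probability.LatticeModels
open Literature.MathematicalPhysics.QuantumManyBody.StateRelaxation
open _root_.Filter
open scoped ComplexOrder BigOperators _root_.Topology

/-- An affine function of the density on `[n₁, n₂]` is at least the smaller endpoint value. [folklore] -/
private theorem min_endpoints_le_affine {C s ν n₁ n₂ n : ℝ} (h₁ : n₁ ≤ n) (h₂ : n ≤ n₂) :
    min (C + s * (n₁ / 2 - ν)) (C + s * (n₂ / 2 - ν)) ≤ C + s * (n / 2 - ν) := by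
  rcases le_total 0 s with hs | hs
  · exact (min_le_left _ _).trans (by nlinarith)
  · exact (min_le_right _ _).trans (by nlinarith)

section FillingBox

/-- **Window certificate ⇒ orbit-mean correlator bound over a whole FILLING BOX.** Data as in
`…re_sum_expect_d4_ge_of_window_certificate_TT'_ineq_of_window`, except that the certified window is
assumed on a box, `lo ≤ energyDensityTT' t t' U x ≤ hi` for all `x ∈ [n₁, n₂]` (`0 ≤ n₁`, `n₂ < 2`).
Conclusion, for EVERY `n ∈ [n₁, n₂]` and every torus-limit ground state `ω` of density `n`:
`min_{e ∈ {n₁,n₂}} (c − Σₖ ‖aₖ‖ + (Σ_σ μ_σ)(e/2 − ν)) ≤ |S|⁻¹ Σ_{γ∈S} Re ω_{γΛ'}(Γ(d4Emb γ 0) X)`.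
[cite: WangEtAl2024, §III] -/
theorem InfVolFermionState.IsTorusLimitOf.re_sum_expect_d4_ge_of_window_certificate_TT'_ineq_of_fillingBox
    (t t' : ℝ) {U : ℝ} (hU : 0 ≤ U) {n₁ n₂ : ℝ} (hn₁ : 0 ≤ n₁) (hn₂ : n₂ < 2) {κp κm lo hi : ℝ}
    (hκp : 0 ≤ κp) (hκm : 0 ≤ κm)
    (hlo : ∀ x ∈ Set.Icc n₁ n₂, lo ≤ ThermodynamicLimit.energyDensityTT' t t' U x)
    (hhi : ∀ x ∈ Set.Icc n₁ n₂, ThermodynamicLimit.energyDensityTT' t t' U x ≤ hi)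
    {Λ Λ' : Finset (Site 2)} (hΛ : Λ ⊆ Λ') (h8 : thicken Λ 1 ⊆ Λ')
    (h0 : thicken ({0} : Finset (Site 2)) 1 ⊆ Λ') (hz : (0 : Site 2) ∈ Λ')
    {S : Finset (DihedralGroup 4)} (h1 : (1 : DihedralGroup 4) ∈ S) (hmul : ∀ a ∈ S, ∀ b ∈ S, a * b ∈ S)
    (Xw : FermionOp Λ') (μ : Fin 2 → ℝ) (ν : ℝ)
    {m : Type*} [Fintype m] [DecidableEq m] {Λm : Matrix m m ℂ} (hΛm : Λm.PosSemidef)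
    (O : m → FermionOp Λ')
    {κ' : Type*} (s : Finset κ') (B : κ' → FermionOp Λ)
    {ι : Type*} (tt : Finset ι) (γ : ι → DihedralGroup 4) (hγS : ∀ l ∈ tt, γ l ∈ S) (wv : ι → Site 2)
    (hsh : ∀ l, d4ShiftSet (γ l) (wv l) Λ ⊆ Λ') (Y : ι → FermionOp Λ)
    {ρ : Type*} (uu : Finset ρ) (b : ρ → ℂ) (cw : ρ → List (Orb (PolySite Λ') × Bool))
    (hcw : ∀ j ∈ uu, ladderCharge (cw j) ≠ 0 ∨ ladderSpinCharge (cw j) ≠ 0)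
    {δ : Type*} (ah : Finset δ) (dc : δ → ℝ) (V : δ → FermionOp Λ')
    {κ'' : Type*} (w : Finset κ'') (a : κ'' → ℂ) (word : κ'' → List (Orb (PolySite Λ') × Bool)) {c : ℝ}
    (hcert : Xw - (c : ℂ) • (1 : FermionOp Λ') -
        ∑ σ : Fin 2, ((μ σ : ℝ) : ℂ) • (nAt 0 hz σ - ((ν : ℝ) : ℂ) • (1 : FermionOp Λ')) -
        ((κp : ℝ) : ℂ) • (((hi : ℝ) : ℂ) • (1 : FermionOp Λ') -
          fermionEmbed (PolySite.incl h0) ((hubbardTTPrimeFermionInteraction t t' U).meanEnergyObs 1)) -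
        ((κm : ℝ) : ℂ) • (fermionEmbed (PolySite.incl h0) ((hubbardTTPrimeFermionInteraction t t' U).meanEnergyObs 1) -
          ((lo : ℝ) : ℂ) • (1 : FermionOp Λ')) =
      gramForm Λm O +
        (∑ k ∈ s, ((hubbardTTPrimeFermionInteraction t t' U).localHamiltonian Λ' * fermionEmbed (PolySite.incl hΛ) (B k) -
            fermionEmbed (PolySite.incl hΛ) (B k) * (hubbardTTPrimeFermionInteraction t t' U).localHamiltonian Λ') +
          ∑ l ∈ tt, (fermionEmbed (PolySite.incl (hsh l)) (fermionEmbed (PolySite.d4Emb (γ l) (wv l) Λ) (Y l)) -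
            fermionEmbed (PolySite.incl hΛ) (Y l)) +
          ∑ j ∈ uu, b j • ladderWord (cw j)) +
        (∑ m' ∈ ah, ((dc m' : ℝ) : ℂ) • ((V m')ᴴ - V m') + ∑ k ∈ w, a k • ladderWord (word k)))
    {n : ℝ} (hn : n ∈ Set.Icc n₁ n₂)
    {Ls : ℕ → ℕ} (hLs : Tendsto Ls atTop atTop)
    {ψ : ∀ L, Fock (Orb (FermionTorus 2 L))}
    (hψ : ∀ j, IsGroundStateInSector (hubbardTorusTT' (Ls j) t t' U)
      (ThermodynamicLimit.rectN n (Ls j)) 0 (ψ (Ls j)))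
    (hψ1 : ∀ j, star (ψ (Ls j)) ⬝ᵥ ψ (Ls j) = 1)
    {ω : InfVolFermionState 2} (hω : ω.IsTorusLimitOf ψ Ls) :
    min (c - ∑ k ∈ w, ‖a k‖ + (∑ σ : Fin 2, μ σ) * (n₁ / 2 - ν))
        (c - ∑ k ∈ w, ‖a k‖ + (∑ σ : Fin 2, μ σ) * (n₂ / 2 - ν)) ≤
      ((S.card : ℝ)⁻¹ * ∑ g ∈ S, (ω.expect (d4ShiftSet g 0 Λ')
        (fermionEmbed (PolySite.d4Emb g 0 Λ') Xw)).re) := by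
  have hn0 : 0 ≤ n := hn₁.trans hn.1
  have hn2 : n < 2 := lt_of_le_of_lt hn.2 hn₂
  have h := hω.re_sum_expect_d4_ge_of_window_certificate_TT'_ineq_of_window t t' hU hn0 hn2 hκp hκm
    (hlo n hn) (hhi n hn) hΛ h8 h0 hz h1 hmul Xw μ ν hΛm O s B tt γ hγS wv hsh Y uu b cw hcw ah dc V w a
    word hcert hLs hψ hψ1
  exact (min_endpoints_le_affine hn.1 hn.2).trans h

/-- **Translation-only certificates with both energy half-spaces ⇒ the correlator of every torus-limit
ground state of EVERY density of a filling box**: under the hypotheses of `…_TT'_ineq_of_window` with all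
`γₗ = 1` and a box window `lo ≤ e(x) ≤ hi` on `[n₁, n₂]`, for every `n ∈ [n₁, n₂]`:
`min_{e ∈ {n₁,n₂}} (c − Σₖ ‖aₖ‖ + (Σ_σ μ_σ)(e/2 − ν)) ≤ Re ω_{Λ'}(X)`. The shape a box engine consumes:
one certificate (checked once), the box window of the filling-box files, two endpoint evaluations.
[cite: WangEtAl2024, §III] -/
theorem InfVolFermionState.IsTorusLimitOf.re_expect_ge_of_window_certificate_TT'_ineq_of_fillingBox
    (t t' : ℝ) {U : ℝ} (hU : 0 ≤ U) {n₁ n₂ : ℝ} (hn₁ : 0 ≤ n₁) (hn₂ : n₂ < 2) {κp κm lo hi : ℝ}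
    (hκp : 0 ≤ κp) (hκm : 0 ≤ κm)
    (hlo : ∀ x ∈ Set.Icc n₁ n₂, lo ≤ ThermodynamicLimit.energyDensityTT' t t' U x)
    (hhi : ∀ x ∈ Set.Icc n₁ n₂, ThermodynamicLimit.energyDensityTT' t t' U x ≤ hi)
    {Λ Λ' : Finset (Site 2)} (hΛ : Λ ⊆ Λ') (h8 : thicken Λ 1 ⊆ Λ')
    (h0 : thicken ({0} : Finset (Site 2)) 1 ⊆ Λ') (hz : (0 : Site 2) ∈ Λ')
    (Xw : FermionOp Λ') (μ : Fin 2 → ℝ) (ν : ℝ)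
    {m : Type*} [Fintype m] [DecidableEq m] {Λm : Matrix m m ℂ} (hΛm : Λm.PosSemidef)
    (O : m → FermionOp Λ')
    {κ' : Type*} (s : Finset κ') (B : κ' → FermionOp Λ)
    {ι : Type*} (tt : Finset ι) (γ : ι → DihedralGroup 4) (hγ1 : ∀ l ∈ tt, γ l = 1) (wv : ι → Site 2)
    (hsh : ∀ l, d4ShiftSet (γ l) (wv l) Λ ⊆ Λ') (Y : ι → FermionOp Λ)
    {ρ : Type*} (uu : Finset ρ) (b : ρ → ℂ) (cw : ρ → List (Orb (PolySite Λ') × Bool))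
    (hcw : ∀ j ∈ uu, ladderCharge (cw j) ≠ 0 ∨ ladderSpinCharge (cw j) ≠ 0)
    {δ : Type*} (ah : Finset δ) (dc : δ → ℝ) (V : δ → FermionOp Λ')
    {κ'' : Type*} (w : Finset κ'') (a : κ'' → ℂ) (word : κ'' → List (Orb (PolySite Λ') × Bool)) {c : ℝ}
    (hcert : Xw - (c : ℂ) • (1 : FermionOp Λ') -
        ∑ σ : Fin 2, ((μ σ : ℝ) : ℂ) • (nAt 0 hz σ - ((ν : ℝ) : ℂ) • (1 : FermionOp Λ')) -
        ((κp : ℝ) : ℂ) • (((hi : ℝ) : ℂ) • (1 : FermionOp Λ') -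
          fermionEmbed (PolySite.incl h0) ((hubbardTTPrimeFermionInteraction t t' U).meanEnergyObs 1)) -
        ((κm : ℝ) : ℂ) • (fermionEmbed (PolySite.incl h0) ((hubbardTTPrimeFermionInteraction t t' U).meanEnergyObs 1) -
          ((lo : ℝ) : ℂ) • (1 : FermionOp Λ')) =
      gramForm Λm O +
        (∑ k ∈ s, ((hubbardTTPrimeFermionInteraction t t' U).localHamiltonian Λ' * fermionEmbed (PolySite.incl hΛ) (B k) -
            fermionEmbed (PolySite.incl hΛ) (B k) * (hubbardTTPrimeFermionInteraction t t' U).localHamiltonian Λ') +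
          ∑ l ∈ tt, (fermionEmbed (PolySite.incl (hsh l)) (fermionEmbed (PolySite.d4Emb (γ l) (wv l) Λ) (Y l)) -
            fermionEmbed (PolySite.incl hΛ) (Y l)) +
          ∑ j ∈ uu, b j • ladderWord (cw j)) +
        (∑ m' ∈ ah, ((dc m' : ℝ) : ℂ) • ((V m')ᴴ - V m') + ∑ k ∈ w, a k • ladderWord (word k)))
    {n : ℝ} (hn : n ∈ Set.Icc n₁ n₂)
    {Ls : ℕ → ℕ} (hLs : Tendsto Ls atTop atTop)
    {ψ : ∀ L, Fock (Orb (FermionTorus 2 L))}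
    (hψ : ∀ j, IsGroundStateInSector (hubbardTorusTT' (Ls j) t t' U)
      (ThermodynamicLimit.rectN n (Ls j)) 0 (ψ (Ls j)))
    (hψ1 : ∀ j, star (ψ (Ls j)) ⬝ᵥ ψ (Ls j) = 1)
    {ω : InfVolFermionState 2} (hω : ω.IsTorusLimitOf ψ Ls) :
    min (c - ∑ k ∈ w, ‖a k‖ + (∑ σ : Fin 2, μ σ) * (n₁ / 2 - ν))
        (c - ∑ k ∈ w, ‖a k‖ + (∑ σ : Fin 2, μ σ) * (n₂ / 2 - ν)) ≤ (ω.expect Λ' Xw).re := by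
  have hn0 : 0 ≤ n := hn₁.trans hn.1
  have hn2 : n < 2 := lt_of_le_of_lt hn.2 hn₂
  have h := hω.re_expect_ge_of_window_certificate_TT'_ineq_of_window t t' hU hn0 hn2 hκp hκm
    (hlo n hn) (hhi n hn) hΛ h8 h0 hz Xw μ ν hΛm O s B tt γ hγ1 wv hsh Y uu b cw hcw ah dc V w a
    word hcert hLs hψ hψ1
  exact (min_endpoints_le_affine hn.1 hn.2).trans h

end FillingBox

end Literature.MathematicalPhysics.QuantumLattice

end
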